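import Mathlib
import HarnessLib
import Literature.RingTheory.CohomologyAnnihilator.Basic
import Summits.ResolutionOfSingularities.ResolutionOfSingularities.Theorems.HomologicalConductorNoZenoBirthDefs
import Summits.ResolutionOfSingularities.ResolutionOfSingularities.Theorems.HomologicalConductorNoZenoTowerNoetherian

/-!
# Route `HomologicalConductor`, kill test `SurfaceTermination` (stmt-ResolutionOfSingularities-16488),
# minimal-resolution DESCENT for rational germs (K44S-DESCENT (R2)) — step lemma:
# **a normal local ring over the stage in which `ca(T_m)` becomes principal contains the next stage**

OURS (cell res-hironaka, crux chain W4.4, seat res-L0-w44-stub-4); nothing here is a statement of the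
manuscript under review (Hironaka 2017); AI-written, weaker than expert review.  Support-level work
(kill test K4.4-s), not crux work.

The one ring-theoretic fact through which THEOREM A (`ca(T_m)·𝒪_{X_min}` invertible,
`…NoZenoCaInvertibleMinRes`) acts on the canonical `ca`-tower: let `T = tower O A m`,
`T⁺ = tower O A (m+1) = loc O (nrm (chart O T))`, let `V ⊆ K` be any subring containing `T⁺`
(the valuation ring `O` itself, the exit divisor of the step, an exceptional prime divisor of the
next stage, …) and let `T ≤ S ≤ V` be a `k`-subalgebra which is RELATIVELY DOMINATED by `V`
(an element of `S` inverted in `V` is inverted in `S`), integrally closed in `K`, and in which the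
extension `ca(T)·S` of the cohomology annihilator is PRINCIPAL.  Then `T⁺ ≤ S`
(`tower_succ_le_of_isPrincipal`).  For us `S = 𝒪_{X,ξ} ⊆ K`, the local ring of the minimal
resolution `X` of `Spec T` at the centre `ξ` of `V`: THEOREM A makes `ca(T)·S` principal, so the
next stage is dominated by a point of `X_min(T)` — the first half of the descent
`N(T⁺) < N(T)` (K44S-DESCENT §2 (b)/(d), res-L0-w44-plan-1) with no blow-up scheme, no `Proj`, no
universal property.

Proof (the «unit trick»): if `g` generates `ca(T)·S` and `x ∈ ca(T)` is an admissible denominator,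
then `x = s·g` with `s ∈ S`, and `g/x ∈ V` because `ca(T) ⊆ x·T⁺ ⊆ x·V`; so `s = x/g` is a unit of
`V` lying in `S`, hence a unit of `S`, i.e. `ca(T)·S = x·S` and every chart generator `c/x` lies in
`S`; `nrm` and `loc` then stay inside `S` by integral closedness and relative domination.

* `coe_mul_inv_mem_tower_succ` — `c * x⁻¹ ∈ T⁺` for `c ∈ ca T`, `x` admissible;
* `inv_mem_tower_succ_of_mem_nrm_chart` — `s⁻¹ ∈ T⁺` for `s ∈ nrm (chart O T)` with `s⁻¹ ∈ O`;
* `coe_mul_inv_mem_of_isPrincipal` — the unit trick: `c * x⁻¹ ∈ S`;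
* `chart_le_of_isPrincipal`, `nrm_chart_le_of_isPrincipal`, **`tower_succ_le_of_isPrincipal`**.

References: J. Lipman, Publ. Math. IHÉS 36 (1969), §4 and Prop. (1.2) [`Lipman1969`] (the descent it
serves); S. Iyengar, R. Takahashi, IMRN 2016, Def. 2.1 [`IyengarTakahashi2014`] (the ideal `ca`).
-/

noncomputable section

-- single-problem summit: the doubled namespace component `ResolutionOfSingularities` is forced
set_option linter.dupNamespace false

namespace Summit.ResolutionOfSingularities.ResolutionOfSingularities.Theorems.SurfaceTermination

open Summit.ResolutionOfSingularities.ResolutionOfSingularities.Theorems.NoZeno.Birth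
open Literature.RingTheory.CohomologyAnnihilator (cohomologyAnnihilator)

variable {k K : Type} [Field k] [Field K] [Algebra k K]

/-! ## Two memberships in the next stage -/

/-- A chart generator lies in the next stage: `c * x⁻¹ ∈ T⁺ = loc O (nrm (chart O T))` for
`c ∈ ca T` and `x ∈ ca T` admissible (`x ≠ 0`, `ca T * x⁻¹ ⊆ O`). [folklore] -/
theorem coe_mul_inv_mem_tower_succ (O : ValuationSubring K) (A : Subalgebra k K) (m : ℕ)
    {c x : K} (hc : c ∈ ca (tower O A m)) (hx : x ∈ ca (tower O A m)) (hx0 : x ≠ 0)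
    (hadm : ∀ c' ∈ ca (tower O A m), c' * x⁻¹ ∈ O) :
    c * x⁻¹ ∈ tower O A (m + 1) := by
  rw [tower_succ]
  have h1 : c * x⁻¹ ∈ chart O (tower O A m) :=
    Algebra.subset_adjoin (Or.inr ⟨c, hc, x, hx, hx0, hadm, rfl⟩)
  have h2 : c * x⁻¹ ∈ nrm (chart O (tower O A m)) :=
    Algebra.subset_adjoin (isIntegral_algebraMap (R := ↥(chart O (tower O A m)))
      (x := (⟨c * x⁻¹, h1⟩ : ↥(chart O (tower O A m)))))
  refine Algebra.subset_adjoin ⟨c * x⁻¹, h2, 1, Subalgebra.one_mem _, ?_, by simp⟩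
  rw [inv_one]; exact O.one_mem

/-- An `O`-unit of `nrm (chart O T)` is inverted in the next stage `T⁺ = loc O (nrm (chart O T))`.
[folklore] -/
theorem inv_mem_tower_succ_of_mem_nrm_chart (O : ValuationSubring K) (A : Subalgebra k K) (m : ℕ)
    {s : K} (hs : s ∈ nrm (chart O (tower O A m))) (hsO : s⁻¹ ∈ O) :
    s⁻¹ ∈ tower O A (m + 1) := by
  rw [tower_succ]
  exact Algebra.subset_adjoin ⟨1, Subalgebra.one_mem _, s, hs, hsO, by simp⟩

/-! ## The unit trick -/

/-- **The unit trick.**  `T = tower O A m ≤ S ≤ V`, `T⁺ = tower O A (m+1) ⊆ V`, `S` relatively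
dominated by `V`, `ca(T)·S` principal; then for `c ∈ ca T` and an admissible denominator `x`,
`c * x⁻¹ ∈ S`.  (If `g` generates `ca(T)·S`: `x = s g`, `g x⁻¹ ∈ V` since `ca T ⊆ x T⁺`, so
`s = x g⁻¹ ∈ S` is a unit of `V`, hence of `S`; `c x⁻¹ = (c g⁻¹)(g x⁻¹)`.) [folklore] -/
theorem coe_mul_inv_mem_of_isPrincipal (O : ValuationSubring K) (A : Subalgebra k K) (m : ℕ)
    (V : Subring K) (hTV : (tower O A (m + 1)).toSubring ≤ V)
    (S : Subalgebra k K) (hTS : tower O A m ≤ S) (hSV : S.toSubring ≤ V)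
    (hdom : ∀ s ∈ S, s⁻¹ ∈ V → s⁻¹ ∈ S)
    (hprinc : (Ideal.map (Subalgebra.inclusion hTS).toRingHom
      (cohomologyAnnihilator ↥(tower O A m))).IsPrincipal)
    {c x : K} (hc : c ∈ ca (tower O A m)) (hx : x ∈ ca (tower O A m)) (hx0 : x ≠ 0)
    (hadm : ∀ c' ∈ ca (tower O A m), c' * x⁻¹ ∈ O) :
    c * x⁻¹ ∈ S := by
  classical
  set T : Subalgebra k K := tower O A m with hT
  set ι : ↥T →+* ↥S := (Subalgebra.inclusion hTS).toRingHom with hι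
  set J : Ideal ↥S := Ideal.map ι (cohomologyAnnihilator ↥T) with hJ
  obtain ⟨g, hg⟩ := hprinc
  -- membership of the images of `ca T` in `J = (g)`
  have hmemJ : ∀ {y : K} (hy : y ∈ ca T), ∃ s : ↥S, y = (s : K) * (g : K) := by
    intro y hy
    have hyT : y ∈ T := ca_subset _ hy
    have hyca : (⟨y, hyT⟩ : ↥T) ∈ cohomologyAnnihilator ↥T := (tn_coe_mem_ca_iff T ⟨y, hyT⟩).mp hy
    have h1 : ι ⟨y, hyT⟩ ∈ J := Ideal.mem_map_of_mem ι hyca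
    rw [hg] at h1
    obtain ⟨s, hs⟩ := Ideal.mem_span_singleton'.mp h1
    refine ⟨s, ?_⟩
    have := congrArg (fun z : ↥S => (z : K)) hs
    simpa [hι] using this.symm
  -- every element of `J` lies in `x · V`
  have hJx : ∀ j ∈ J, (j : K) * x⁻¹ ∈ V := by
    -- the elements of `S` whose quotient by `x` lies in `V` form an ideal containing the generators
    let P : Ideal ↥S :=
      { carrier := {j | (j : K) * x⁻¹ ∈ V}
        add_mem' := by
          intro a b ha hb
          simp only [Set.mem_setOf_eq, Subalgebra.coe_add, add_mul] at ha hb ⊢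
          exact V.add_mem ha hb
        zero_mem' := by simp [V.zero_mem]
        smul_mem' := by
          intro a b hb
          simp only [Set.mem_setOf_eq, smul_eq_mul, Subalgebra.coe_mul, mul_assoc] at hb ⊢
          exact V.mul_mem (hSV (Subalgebra.mem_toSubring.mpr a.2)) hb }
    have hle : J ≤ P := by
      rw [hJ, Ideal.map_le_iff_le_comap]
      intro y hy
      have hyK : (y : K) ∈ ca T := (tn_coe_mem_ca_iff T y).mpr hy
      change ((ι y : ↥S) : K) * x⁻¹ ∈ V
      have : ((ι y : ↥S) : K) = (y : K) := rfl
      rw [this]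
      exact hTV (Subalgebra.mem_toSubring.mpr (coe_mul_inv_mem_tower_succ O A m hyK hx hx0 hadm))
    intro j hj
    exact hle hj
  -- `g x⁻¹ ∈ V`
  have hgJ : g ∈ J := by rw [hg]; exact Ideal.mem_span_singleton_self g
  have hgx : (g : K) * x⁻¹ ∈ V := hJx g hgJ
  -- `x = s g`
  obtain ⟨s, hs⟩ := hmemJ hx
  have hg0 : (g : K) ≠ 0 := by
    intro h
    apply hx0
    rw [hs, h, mul_zero]
  have hs0 : (s : K) ≠ 0 := by
    intro h
    apply hx0
    rw [hs, h, zero_mul]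
  -- `s⁻¹ = g x⁻¹ ∈ V`, hence `s⁻¹ ∈ S`
  have hsinv : (s : K)⁻¹ = (g : K) * x⁻¹ := by
    rw [hs, mul_inv, mul_comm ((s : K)⁻¹) ((g : K)⁻¹), ← mul_assoc, mul_inv_cancel₀ hg0, one_mul]
  have hsinvS : (s : K)⁻¹ ∈ S := hdom (s : K) s.2 (by rw [hsinv]; exact hgx)
  -- `c = s_c g`, so `c x⁻¹ = s_c · (g x⁻¹) = s_c · s⁻¹`
  obtain ⟨sc, hsc⟩ := hmemJ hc
  have : c * x⁻¹ = (sc : K) * (s : K)⁻¹ := by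
    rw [hsinv, hsc, mul_assoc]
  rw [this]
  exact S.mul_mem sc.2 hsinvS

/-! ## The next stage lies in `S` -/

/-- The chart lies in `S`. [folklore] -/
theorem chart_le_of_isPrincipal (O : ValuationSubring K) (A : Subalgebra k K) (m : ℕ)
    (V : Subring K) (hTV : (tower O A (m + 1)).toSubring ≤ V)
    (S : Subalgebra k K) (hTS : tower O A m ≤ S) (hSV : S.toSubring ≤ V)
    (hdom : ∀ s ∈ S, s⁻¹ ∈ V → s⁻¹ ∈ S)
    (hprinc : (Ideal.map (Subalgebra.inclusion hTS).toRingHom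
      (cohomologyAnnihilator ↥(tower O A m))).IsPrincipal) :
    chart O (tower O A m) ≤ S := by
  refine Algebra.adjoin_le ?_
  rintro y (hy | ⟨c, hc, x, hx, hx0, hadm, rfl⟩)
  · exact hTS hy
  · exact coe_mul_inv_mem_of_isPrincipal O A m V hTV S hTS hSV hdom hprinc hc hx hx0 hadm

/-- The normalised chart lies in `S` (`S` integrally closed in `K`). [folklore] -/
theorem nrm_chart_le_of_isPrincipal (O : ValuationSubring K) (A : Subalgebra k K) (m : ℕ)
    (V : Subring K) (hTV : (tower O A (m + 1)).toSubring ≤ V)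
    (S : Subalgebra k K) (hTS : tower O A m ≤ S) (hSV : S.toSubring ≤ V)
    (hdom : ∀ s ∈ S, s⁻¹ ∈ V → s⁻¹ ∈ S) (hSint : ∀ y : K, IsIntegral ↥S y → y ∈ S)
    (hprinc : (Ideal.map (Subalgebra.inclusion hTS).toRingHom
      (cohomologyAnnihilator ↥(tower O A m))).IsPrincipal) :
    nrm (chart O (tower O A m)) ≤ S := by
  have hcS : chart O (tower O A m) ≤ S := chart_le_of_isPrincipal O A m V hTV S hTS hSV hdom hprinc
  refine Algebra.adjoin_le ?_
  rintro y ⟨p, hp, hpy⟩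
  refine hSint y ⟨p.map (Subalgebra.inclusion hcS).toRingHom, hp.map _, ?_⟩
  have hcomp : (algebraMap ↥S K).comp (Subalgebra.inclusion hcS).toRingHom =
      algebraMap ↥(chart O (tower O A m)) K := RingHom.ext fun _ => rfl
  rw [Polynomial.eval₂_map, hcomp]
  exact hpy

/-- **The next stage lies in `S`.**  `T = tower O A m ≤ S ≤ V ⊇ T⁺ = tower O A (m+1)`, `S`
relatively dominated by `V` and integrally closed in `K`, `ca(T)·S` principal ⇒ `T⁺ ≤ S`.
[folklore] -/
theorem tower_succ_le_of_isPrincipal (O : ValuationSubring K) (A : Subalgebra k K) (m : ℕ)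
    (V : Subring K) (hTV : (tower O A (m + 1)).toSubring ≤ V)
    (S : Subalgebra k K) (hTS : tower O A m ≤ S) (hSV : S.toSubring ≤ V)
    (hdom : ∀ s ∈ S, s⁻¹ ∈ V → s⁻¹ ∈ S) (hSint : ∀ y : K, IsIntegral ↥S y → y ∈ S)
    (hprinc : (Ideal.map (Subalgebra.inclusion hTS).toRingHom
      (cohomologyAnnihilator ↥(tower O A m))).IsPrincipal) :
    tower O A (m + 1) ≤ S := by
  have hnS : nrm (chart O (tower O A m)) ≤ S :=
    nrm_chart_le_of_isPrincipal O A m V hTV S hTS hSV hdom hSint hprinc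
  rw [tower_succ]
  refine Algebra.adjoin_le ?_
  rintro y ⟨a, ha, s, hs, hsO, rfl⟩
  have hsinv : s⁻¹ ∈ S :=
    hdom s (hnS hs) (hTV (Subalgebra.mem_toSubring.mpr (inv_mem_tower_succ_of_mem_nrm_chart O A m hs hsO)))
  exact S.mul_mem (hnS ha) hsinv

/-- **Relative domination of the next stage.**  In the situation of `tower_succ_le_of_isPrincipal`, if
moreover `V` relatively dominates `T⁺` then `S` relatively dominates `T⁺`: an element of `T⁺` inverted
in `S` is inverted in `T⁺`. [folklore] -/
theorem inv_mem_tower_succ_of_inv_mem (O : ValuationSubring K) (A : Subalgebra k K) (m : ℕ)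
    (V : Subring K) (S : Subalgebra k K) (hSV : S.toSubring ≤ V)
    (hVdom : ∀ t ∈ tower O A (m + 1), t⁻¹ ∈ V → t⁻¹ ∈ tower O A (m + 1))
    {t : K} (ht : t ∈ tower O A (m + 1)) (htS : t⁻¹ ∈ S) : t⁻¹ ∈ tower O A (m + 1) :=
  hVdom t ht (hSV (Subalgebra.mem_toSubring.mpr htS))

end Summit.ResolutionOfSingularities.ResolutionOfSingularities.Theorems.SurfaceTermination

end
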